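import Summits.NavierStokesRegularity.NavierStokesRegularity.Theorems.HodographBetchovEquivalence
import Summits.NavierStokesRegularity.NavierStokesRegularity.Theorems.HodographBetchovFastClassSqueezeSplit

/-!
# Route `HodographBetchov`: the pieces of the `FastClassSqueeze` split are necessary for Clay (A)

The BC2 split of crux 3 (`Cruxes/FastClassSqueeze/STRATEGY-CENSUS.md`) replaced `FastClassSqueeze` by the two route
leaves X₁ = `NoFastEnergyConcentration` (stmt-18118) and X₂ = `FastGradientSerrinStarved` (stmt-18120), glued by the
landed `Split.fastClassSqueeze_of_pieces`.  This file completes the logical map of `HodographBetchovEquivalence.lean`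
one level down, certifying what the census (§2(c), "caveat recorded for the auditor") states in prose:

* `noFastEnergyConcentration_conclusion_of_bounded`, `fastGradientSerrinStarved_conclusion_of_bounded` — for a
  field bounded on `[0,T) × ℝ³` both conclusions are trivial (the fast class one unit above the bound is empty);
* `noFastEnergyConcentration_of_noBlowup`, `fastGradientSerrinStarved_of_noBlowup` — hence both pieces follow from
  the no-blow-up packaging of Clay (A) (`FastClassSqueeze.bounded_of_hasSmoothExtensionPast`);
* `noFastEnergyConcentration_of_navierStokesRegularity`, `fastGradientSerrinStarved_of_navierStokesRegularity` —
  NECESSITY: Clay (A) implies each piece (`noBlowup_of_navierStokesRegularity`); contrapositives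
  `not_navierStokesRegularity_of_not_…`: a refutation of either piece is a finite-time blow-up from a Schwartz datum;
* `navierStokesRegularity_iff_pieces` — `NavierStokesRegularity ↔ SlowClassProduction ∧ NoFastEnergyConcentration ∧
  FastGradientSerrinStarved` (sufficiency through the glue and `navierStokesRegularity_of_classBudgets`);
* `noFastEnergyConcentration_iff_navierStokesRegularity`, `fastGradientSerrinStarved_iff_navierStokesRegularity` —
  the CONDITIONAL summit-equivalences given the other leaves (the `summit_equivalent (conditional)` signal one level
  down, by construction — not evidence of restatement).

Pure logic over landed theorems; no analysis.
-/

noncomputable section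

open Set MeasureTheory Filter Topology Function

-- the summit and its single sub-problem share the name (CONVENTIONS §1), as in every Theorems file
set_option linter.dupNamespace false

namespace Summit.NavierStokesRegularity.NavierStokesRegularity.Theorems.HodographBetchov

open Literature.Analysis Literature.Analysis.FluidPDE
open Summit.NavierStokesRegularity.NavierStokesRegularity.Theses.HodographBetchov
open scoped ENNReal

/-! ### Bounded fields: both conclusions are trivial -/

/-- For a field bounded by `M` on `[0,T) × ℝ³` the fast class of level `max M 0 + 1` is empty at every
`t ∈ [0,T)`. [folklore] -/
theorem fastClass_eq_empty_of_bounded (T : ℝ) (u : ℝ → EuclideanSpace ℝ (Fin 3) → EuclideanSpace ℝ (Fin 3))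
    (M : ℝ) (hM : ∀ t ∈ Set.Ico 0 T, ∀ x, ‖u t x‖ ≤ M) {t : ℝ} (ht : t ∈ Set.Ico 0 T) :
    {x : EuclideanSpace ℝ (Fin 3) | max M 0 + 1 < ‖u t x‖} = ∅ := by
  ext x
  simp only [mem_setOf_eq, mem_empty_iff_false, iff_false, not_lt]
  have hx := hM t ht x
  linarith [le_max_left M 0]

/-- **X₁'s conclusion for a bounded field**: with `l = max M 0 + 1` every fast class is empty, so its energy is
`0 ≤ ε`. [folklore] -/
theorem noFastEnergyConcentration_conclusion_of_bounded (T : ℝ)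
    (u : ℝ → EuclideanSpace ℝ (Fin 3) → EuclideanSpace ℝ (Fin 3)) (M : ℝ)
    (hM : ∀ t ∈ Set.Ico 0 T, ∀ x, ‖u t x‖ ≤ M) :
    ∀ ε : ℝ, 0 < ε → ∃ l : ℝ, 0 < l ∧ ∀ t ∈ Set.Ico 0 T,
      ∫⁻ x in {x : EuclideanSpace ℝ (Fin 3) | l < ‖u t x‖}, ‖u t x‖ₑ ^ 2 ≤ ENNReal.ofReal ε := by
  intro ε _
  refine ⟨max M 0 + 1, by positivity, fun t ht => ?_⟩
  rw [fastClass_eq_empty_of_bounded T u M hM ht, setLIntegral_empty]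
  exact bot_le

/-- **X₂'s conclusion for a bounded field**: with `l = max M 0 + 1` and `q = 2` every fast class is empty, the inner
integral vanishes, `0 ^ 2 = 0`, and the time integral is `0 < ⊤`. [folklore] -/
theorem fastGradientSerrinStarved_conclusion_of_bounded (T : ℝ)
    (u : ℝ → EuclideanSpace ℝ (Fin 3) → EuclideanSpace ℝ (Fin 3)) (M : ℝ)
    (hM : ∀ t ∈ Set.Ico 0 T, ∀ x, ‖u t x‖ ≤ M) :
    ∃ l : ℝ, 0 < l ∧ ∃ q : ℝ, 3 / 2 < q ∧
      ∫⁻ t in Set.Ioo 0 T, (∫⁻ x in {x : EuclideanSpace ℝ (Fin 3) | l < ‖u t x‖},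
        ENNReal.ofReal ‖fderiv ℝ (u t) x‖ ^ q) ^ (2 / (2 * q - 3)) < ⊤ := by
  refine ⟨max M 0 + 1, by positivity, 2, by norm_num, ?_⟩
  have h0 : ∀ t ∈ Set.Ioo 0 T, (∫⁻ x in {x : EuclideanSpace ℝ (Fin 3) | max M 0 + 1 < ‖u t x‖},
      ENNReal.ofReal ‖fderiv ℝ (u t) x‖ ^ (2 : ℝ)) ^ (2 / (2 * 2 - 3) : ℝ) = 0 := by
    intro t ht
    rw [fastClass_eq_empty_of_bounded T u M hM (Ioo_subset_Ico_self ht), setLIntegral_empty]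
    exact ENNReal.zero_rpow_of_pos (by norm_num)
  rw [setLIntegral_congr_fun measurableSet_Ioo h0, lintegral_zero]
  exact ENNReal.zero_lt_top

/-! ### The pieces from no blow-up, and from Clay (A) -/

/-- **X₁ from no blow-up.** If every flow of the route extends classically past `T`, then `NoFastEnergyConcentration`
holds (such a flow is bounded on `[0,T) × ℝ³`, `FastClassSqueeze.bounded_of_hasSmoothExtensionPast`). [folklore] -/
theorem noFastEnergyConcentration_of_noBlowup
    (hNB : ∀ (ν T : ℝ), 0 < ν → 0 < T →
      ∀ (u : ℝ → EuclideanSpace ℝ (Fin 3) → EuclideanSpace ℝ (Fin 3))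
        (p : ℝ → EuclideanSpace ℝ (Fin 3) → ℝ),
        IsClassicalNSSolutionOn (Set.Ico 0 T) ν 0 u p → IsLerayHopfOn T ν 0 (u 0) u →
        HasRapidSpatialDecay (u 0) → HasSmoothExtensionPast ν 0 u T) :
    NoFastEnergyConcentration := by
  intro ν T hν hT u p hcl hLH hdec
  obtain ⟨M, hM⟩ := FastClassSqueeze.bounded_of_hasSmoothExtensionPast ν T hν hT u p hcl hLH hdec
    (hNB ν T hν hT u p hcl hLH hdec)
  exact noFastEnergyConcentration_conclusion_of_bounded T u M hM

/-- **X₂ from no blow-up.** If every flow of the route extends classically past `T`, then `FastGradientSerrinStarved`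
holds (its hypothesis is not even used: a bounded flow has an empty high fast class). [folklore] -/
theorem fastGradientSerrinStarved_of_noBlowup
    (hNB : ∀ (ν T : ℝ), 0 < ν → 0 < T →
      ∀ (u : ℝ → EuclideanSpace ℝ (Fin 3) → EuclideanSpace ℝ (Fin 3))
        (p : ℝ → EuclideanSpace ℝ (Fin 3) → ℝ),
        IsClassicalNSSolutionOn (Set.Ico 0 T) ν 0 u p → IsLerayHopfOn T ν 0 (u 0) u →
        HasRapidSpatialDecay (u 0) → HasSmoothExtensionPast ν 0 u T) :
    FastGradientSerrinStarved := by
  intro ν T hν hT u p hcl hLH hdec _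
  obtain ⟨M, hM⟩ := FastClassSqueeze.bounded_of_hasSmoothExtensionPast ν T hν hT u p hcl hLH hdec
    (hNB ν T hν hT u p hcl hLH hdec)
  exact fastGradientSerrinStarved_conclusion_of_bounded T u M hM

/-- **NECESSITY of X₁: `NavierStokesRegularity → NoFastEnergyConcentration`** (Clay (A) rules out blow-up,
`noBlowup_of_navierStokesRegularity`). [folklore] -/
theorem noFastEnergyConcentration_of_navierStokesRegularity (hA : _root_.NavierStokesRegularity) :
    NoFastEnergyConcentration :=
  noFastEnergyConcentration_of_noBlowup (noBlowup_of_navierStokesRegularity hA)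

/-- **NECESSITY of X₂: `NavierStokesRegularity → FastGradientSerrinStarved`.** [folklore] -/
theorem fastGradientSerrinStarved_of_navierStokesRegularity (hA : _root_.NavierStokesRegularity) :
    FastGradientSerrinStarved :=
  fastGradientSerrinStarved_of_noBlowup (noBlowup_of_navierStokesRegularity hA)

/-- A refutation of X₁ refutes Clay (A): it is a finite-time blow-up from a Schwartz datum. [folklore] -/
theorem not_navierStokesRegularity_of_not_noFastEnergyConcentration (h : ¬ NoFastEnergyConcentration) :
    ¬ _root_.NavierStokesRegularity :=
  fun hA => h (noFastEnergyConcentration_of_navierStokesRegularity hA)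

/-- A refutation of X₂ refutes Clay (A). [folklore] -/
theorem not_navierStokesRegularity_of_not_fastGradientSerrinStarved (h : ¬ FastGradientSerrinStarved) :
    ¬ _root_.NavierStokesRegularity :=
  fun hA => h (fastGradientSerrinStarved_of_navierStokesRegularity hA)

/-! ### The route after the split: `NSR ↔ SCP ∧ X₁ ∧ X₂` -/

/-- **The route's leaves after the split are jointly equivalent to Clay (A):**
`NavierStokesRegularity ↔ SlowClassProduction ∧ NoFastEnergyConcentration ∧ FastGradientSerrinStarved`
(`←`: the landed glue `Split.fastClassSqueeze_of_pieces` and `navierStokesRegularity_of_classBudgets`; `→`: necessity of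
each leaf). [folklore] -/
theorem navierStokesRegularity_iff_pieces : _root_.NavierStokesRegularity ↔ Summit.NavierStokesRegularity.NavierStokesRegularity.Theses.HodographBetchov.SlowClassProduction ∧ Summit.NavierStokesRegularity.NavierStokesRegularity.Theses.HodographBetchov.NoFastEnergyConcentration ∧ Summit.NavierStokesRegularity.NavierStokesRegularity.Theses.HodographBetchov.FastGradientSerrinStarved :=
  ⟨fun hA => ⟨slowClassProduction_of_navierStokesRegularity hA,
      noFastEnergyConcentration_of_navierStokesRegularity hA, fastGradientSerrinStarved_of_navierStokesRegularity hA⟩,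
    fun h => navierStokesRegularity_of_classBudgets h.1
      (FastClassSqueeze.Split.fastClassSqueeze_of_pieces h.2.1 h.2.2)⟩

/-- **Conditional summit-equivalence of X₁** given the other two leaves. [folklore] -/
theorem noFastEnergyConcentration_iff_navierStokesRegularity (h₁ : SlowClassProduction)
    (h₃ : FastGradientSerrinStarved) : NoFastEnergyConcentration ↔ _root_.NavierStokesRegularity :=
  ⟨fun h₂ => navierStokesRegularity_iff_pieces.2 ⟨h₁, h₂, h₃⟩, noFastEnergyConcentration_of_navierStokesRegularity⟩

/-- **Conditional summit-equivalence of X₂** given the other two leaves. [folklore] -/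
theorem fastGradientSerrinStarved_iff_navierStokesRegularity (h₁ : SlowClassProduction)
    (h₂ : NoFastEnergyConcentration) : FastGradientSerrinStarved ↔ _root_.NavierStokesRegularity :=
  ⟨fun h₃ => navierStokesRegularity_iff_pieces.2 ⟨h₁, h₂, h₃⟩, fastGradientSerrinStarved_of_navierStokesRegularity⟩

/-- If Clay (A) fails, one of the three leaves fails (which one is not decided here). [folklore] -/
theorem not_leaf_of_not_navierStokesRegularity (h : ¬ _root_.NavierStokesRegularity) :
    ¬ SlowClassProduction ∨ ¬ NoFastEnergyConcentration ∨ ¬ FastGradientSerrinStarved := by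
  by_contra hcon
  push Not at hcon
  exact h (navierStokesRegularity_iff_pieces.2 hcon)

end Summit.NavierStokesRegularity.NavierStokesRegularity.Theorems.HodographBetchov

end
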